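import Mathlib.Topology.UniformSpace.UniformApproximation
import Literature.Probability.LatticeModels.ScalingLimit
import Literature.Barriers.CriticalPhenomena.TwoPointLawNotMoebius
import HarnessLib

/-!
# Route GaussianScaleMixture — crux `RotationUpgradeFromTwoPoint` (stmt-CriticalPhenomena-8367),
# line `two-crystals-generate-so3`, stub `stub_latticeSymmetryTransport`

THEOREM-ONLY file (no definitions, no named facts). **Lattice symmetries pass to continuous
pointwise scaling limits.** In any dimension `d`, for any lattice family `G : LatticeCorrFamily d`
invariant under an integer matrix `M ∈ GL_d(ℤ)` (two-sided integer inverse `N`), every pointwise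
scaling limit `S` of `G` (any renormalisation `ρ`) which is continuous on `NonCoincident`
satisfies `S n (M x₁, …, M xₙ) = S n (x₁, …, xₙ)` on non-coincident configurations.

Proof ("cell straddling with a rounding defect"). Fix `n` and `x`. For `δ > 0` and `y ∈ ℝ^d` put
`r(δ, y) := [M y / δ] - M [y / δ] ∈ ℤ^d` (coordinatewise integer parts). By `M`-invariance of `G`
and `M (N r) = r`,
`G ([M xᵢ/δ])ᵢ = G (M ([xᵢ/δ] + N rᵢ))ᵢ = G ([xᵢ/δ] + N rᵢ)ᵢ = G ([(xᵢ + δ N rᵢ)/δ])ᵢ`,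
so the rescaled correlator at `M x` equals the rescaled correlator at the shifted configuration
`g(δ) := (xᵢ + δ N r(δ, xᵢ))ᵢ`. Since `δ [c/δ] → c` as `δ → 0⁺` (tree
`ScaleNotMoebius.tendsto_mesh_mul_floor`), `δ r(δ, y) → M y - M y = 0`, whence
`g(δ) → x`; locally uniform convergence on the open set `NonCoincident` together with continuity
of `S n` at `x` gives `F_δ (g δ) → S n x` (`TendstoLocallyUniformlyOn.tendsto_comp`), while
`F_δ (M x) → S n (M x)` (`M` is injective, so `M x` is non-coincident). Conclude by uniqueness
of limits. Continuity is genuinely needed (discontinuous pointwise limits exist).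
-/

noncomputable section

open Literature.Probability.LatticeModels Finset Filter
open Literature.Barriers.CriticalPhenomena.ScaleNotMoebius (tendsto_mesh_mul_floor)
open scoped Topology

namespace Summit.CriticalPhenomena.Ising3DConformalLimit.Cruxes.RotationUpgradeFromTwoPoint.TwoCrystalsGenerateSo3

/-- Coordinates of the real action of an integer matrix: `(M v)ⱼ = Σ_k M_{jk} v_k`. [folklore] -/
theorem lst_toEuclideanLin_map_apply {d : ℕ} (M : Matrix (Fin d) (Fin d) ℤ)
    (v : EuclideanSpace ℝ (Fin d)) (j : Fin d) :
    Matrix.toEuclideanLin (M.map ((↑) : ℤ → ℝ)) v j = ∑ k, (M j k : ℝ) * v k := by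
  simp [Matrix.toEuclideanLin, Matrix.toLpLin_apply, Matrix.mulVec, dotProduct]

/-- Casting a product of integer matrices to `ℝ`. [folklore] -/
theorem lst_map_mul_intCast {d : ℕ} (M N : Matrix (Fin d) (Fin d) ℤ) :
    (M * N).map ((↑) : ℤ → ℝ) = M.map ((↑) : ℤ → ℝ) * N.map ((↑) : ℤ → ℝ) :=
  Matrix.map_mul (f := Int.castRingHom ℝ)

/-- The real actions of mutually inverse integer matrices are mutually inverse:
`N (M v) = v` when `N * M = 1`. [folklore] -/
theorem lst_toEuclideanLin_map_leftInverse {d : ℕ} {M N : Matrix (Fin d) (Fin d) ℤ}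
    (hNM : N * M = 1) :
    Function.LeftInverse (Matrix.toEuclideanLin (N.map ((↑) : ℤ → ℝ)))
      (Matrix.toEuclideanLin (M.map ((↑) : ℤ → ℝ))) := by
  intro v
  have hmap : N.map ((↑) : ℤ → ℝ) * M.map ((↑) : ℤ → ℝ) = 1 := by
    rw [← lst_map_mul_intCast, hNM]
    exact Matrix.map_one _ Int.cast_zero Int.cast_one
  rw [Matrix.toLpLin_apply, Matrix.toLpLin_apply, WithLp.ofLp_toLp, Matrix.mulVec_mulVec, hmap,
    Matrix.one_mulVec, WithLp.toLp_ofLp]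

/-- **Registered stub `stub_latticeSymmetryTransport`.** Lattice symmetries pass to continuous
pointwise scaling limits: for a lattice family `G` on `ℤ^d` invariant under `M ∈ GL_d(ℤ)`
(integer inverse `N`), every pointwise scaling limit `S` of `G` that is continuous on
`NonCoincident` is invariant under the real-linear map of `M` on non-coincident configurations.
[folklore] -/
theorem stub_latticeSymmetryTransport :
  ∀ (d : ℕ) (G : LatticeCorrFamily d) (ρ : ℝ → ℝ) (S : CorrFamily d)
    (M N : Matrix (Fin d) (Fin d) ℤ), M * N = 1 → N * M = 1 →
    (∀ (n : ℕ) (k : Fin n → Site d), G n (fun i => M.mulVec (k i)) = G n k) →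
    HasPointwiseScalingLimit G ρ S →
    (∀ n, ContinuousOn (S n) (NonCoincident d n)) →
    ∀ (n : ℕ) (x : Fin n → EuclideanSpace ℝ (Fin d)), x ∈ NonCoincident d n →
      S n (fun i => Matrix.toEuclideanLin (M.map ((↑) : ℤ → ℝ)) (x i)) = S n x := by
  intro d G ρ S M N hMN hNM hG hlim hcont n x hx
  set T := Matrix.toEuclideanLin (M.map ((↑) : ℤ → ℝ)) with hT
  have hTapp : ∀ (v : EuclideanSpace ℝ (Fin d)) (j : Fin d), T v j = ∑ k, (M j k : ℝ) * v k :=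
    fun v j => lst_toEuclideanLin_map_apply M v j
  -- the rounding defect `r δ y = [T y/δ] - M [y/δ]` and the shifted configuration `g δ`
  obtain ⟨r, hr⟩ : ∃ r : ℝ → EuclideanSpace ℝ (Fin d) → Site d,
      ∀ δ y, r δ y = latticeApprox δ (T y) - M.mulVec (latticeApprox δ y) := ⟨_, fun _ _ => rfl⟩
  obtain ⟨g, hg⟩ : ∃ g : ℝ → (Fin n → EuclideanSpace ℝ (Fin d)), ∀ δ i,
      g δ i = x i + WithLp.toLp 2 (fun j => δ * (((N.mulVec (r δ (x i))) j : ℤ) : ℝ)) :=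
    ⟨fun δ i => x i + WithLp.toLp 2 (fun j => δ * (((N.mulVec (r δ (x i))) j : ℤ) : ℝ)),
      fun _ _ => rfl⟩
  -- (1) `T x` is non-coincident
  have hTx : (fun i => T (x i)) ∈ NonCoincident d n := by
    rw [mem_nonCoincident] at hx ⊢
    exact (lst_toEuclideanLin_map_leftInverse hNM).injective.comp hx
  -- (2) the algebraic identity `F_δ (g δ) = F_δ (T x)` for `δ > 0`
  have hdefect : ∀ (δ : ℝ) (y : EuclideanSpace ℝ (Fin d)),
      latticeApprox δ (T y) = M.mulVec (latticeApprox δ y + N.mulVec (r δ y)) := by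
    intro δ y
    rw [Matrix.mulVec_add, Matrix.mulVec_mulVec, hMN, Matrix.one_mulVec, hr, add_sub_cancel]
  have hshift : ∀ δ : ℝ, 0 < δ → ∀ i,
      latticeApprox δ (g δ i) = latticeApprox δ (x i) + N.mulVec (r δ (x i)) := by
    intro δ hδ i
    funext j
    rw [Pi.add_apply, latticeApprox_apply, latticeApprox_apply, hg, PiLp.add_apply,
      PiLp.toLp_apply, add_div, mul_div_cancel_left₀ _ hδ.ne', Int.floor_add_intCast]
  have heq : ∀ᶠ δ in 𝓝[>] (0 : ℝ),
      rescaledCorrelator G ρ n δ (g δ) = rescaledCorrelator G ρ n δ (fun i => T (x i)) := by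
    filter_upwards [self_mem_nhdsWithin] with δ hδ
    have hδ' : 0 < δ := hδ
    rw [rescaledCorrelator_apply, rescaledCorrelator_apply]
    congr 1
    have h1 : (fun i => latticeApprox δ (T (x i))) =
        fun i => M.mulVec (latticeApprox δ (x i) + N.mulVec (r δ (x i))) :=
      funext fun i => hdefect δ (x i)
    have h2 : (fun i => latticeApprox δ (g δ i)) =
        fun i => latticeApprox δ (x i) + N.mulVec (r δ (x i)) :=
      funext fun i => hshift δ hδ' i
    rw [h1, hG, h2]
  -- (3) `g δ → x` as `δ → 0⁺`: each coordinate of the shift `δ N r(δ, y)` tends to `0`,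
  -- because `δ [c/δ] → c` turns `δ r(δ, y)` into `M y - M y = 0` in the limit
  have hcoord : ∀ (y : EuclideanSpace ℝ (Fin d)) (j : Fin d),
      Tendsto (fun δ : ℝ => δ * (((N.mulVec (r δ y)) j : ℤ) : ℝ)) (𝓝[>] 0) (𝓝 0) := by
    intro y j
    have hexp : ∀ δ : ℝ, δ * (((N.mulVec (r δ y)) j : ℤ) : ℝ) =
        ∑ k, (N j k : ℝ) * (δ * (⌊T y k / δ⌋ : ℝ) - ∑ l, (M k l : ℝ) * (δ * (⌊y l / δ⌋ : ℝ))) := by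
      intro δ
      rw [hr]
      simp only [Matrix.mulVec, dotProduct, Pi.sub_apply, latticeApprox_apply, Int.cast_sum,
        Int.cast_mul, Int.cast_sub]
      rw [Finset.mul_sum]
      refine Finset.sum_congr rfl fun k _ => ?_
      have hin : ∑ l, (M k l : ℝ) * (δ * (⌊y l / δ⌋ : ℝ)) =
          δ * ∑ l, (M k l : ℝ) * (⌊y l / δ⌋ : ℝ) := by
        rw [Finset.mul_sum]
        exact Finset.sum_congr rfl fun l _ => by ring
      rw [hin]
      ring
    have hk : ∀ k : Fin d, Tendsto
        (fun δ : ℝ => δ * (⌊T y k / δ⌋ : ℝ) - ∑ l, (M k l : ℝ) * (δ * (⌊y l / δ⌋ : ℝ)))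
        (𝓝[>] 0) (𝓝 0) := by
      intro k
      have h0 : T y k - ∑ l, (M k l : ℝ) * y l = 0 := by rw [hTapp, sub_self]
      have h := (tendsto_mesh_mul_floor (T y k)).sub
        (tendsto_finsetSum (Finset.univ : Finset (Fin d))
          fun l (_ : l ∈ Finset.univ) => (tendsto_mesh_mul_floor (y l)).const_mul (M k l : ℝ))
      rw [h0] at h
      exact h
    have hsum := tendsto_finsetSum (Finset.univ : Finset (Fin d))
      fun k (_ : k ∈ Finset.univ) => (hk k).const_mul (N j k : ℝ)
    simp only [mul_zero, Finset.sum_const_zero] at hsum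
    exact hsum.congr fun δ => (hexp δ).symm
  have hg_tendsto : Tendsto g (𝓝[>] 0) (𝓝 x) := by
    rw [tendsto_pi_nhds]
    intro i
    have h1 : Tendsto (fun δ : ℝ => fun j : Fin d => δ * (((N.mulVec (r δ (x i))) j : ℤ) : ℝ))
        (𝓝[>] 0) (𝓝 0) :=
      tendsto_pi_nhds.2 fun j => hcoord (x i) j
    have h2 : Tendsto
        (fun δ : ℝ => WithLp.toLp 2 (fun j : Fin d => δ * (((N.mulVec (r δ (x i))) j : ℤ) : ℝ)))
        (𝓝[>] 0) (𝓝 (WithLp.toLp 2 (0 : Fin d → ℝ))) :=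
      ((PiLp.continuous_toLp 2 (fun _ : Fin d => ℝ)).tendsto 0).comp h1
    rw [WithLp.toLp_zero] at h2
    have h3 := h2.const_add (x i)
    rw [add_zero] at h3
    refine h3.congr fun δ => ?_
    rw [hg]
  -- (4) the two limits of the same function
  have hlim1 : Tendsto (fun δ => rescaledCorrelator G ρ n δ (fun i => T (x i))) (𝓝[>] 0)
      (𝓝 (S n (fun i => T (x i)))) :=
    (hlim n).tendsto_at hTx
  have hgw : Tendsto g (𝓝[>] 0) (𝓝[NonCoincident d n] x) := by
    rw [(isOpen_nonCoincident d n).nhdsWithin_eq hx]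
    exact hg_tendsto
  have hlim2 : Tendsto (fun δ => rescaledCorrelator G ρ n δ (g δ)) (𝓝[>] 0) (𝓝 (S n x)) :=
    (hlim n).tendsto_comp (hcont n x hx) hx hgw
  exact tendsto_nhds_unique hlim1 (hlim2.congr' heq)

end Summit.CriticalPhenomena.Ising3DConformalLimit.Cruxes.RotationUpgradeFromTwoPoint.TwoCrystalsGenerateSo3

end
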